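import Literature.AnabelianGeometry.SemiGraphs.GaloisObjectsOfSubgroups
import Literature.AnabelianGeometry.SemiGraphs.BoundedDegreeCoveringsFinite
import Literature.AnabelianGeometry.SemiGraphs.GaloisLevelDataOfSeq
import HarnessLib

/-!
# The CHARACTERISTIC Galois tower of a finite coherent semi-graph of anabelioids ([SemiAnbd] Prop 3.6 / Ex 3.10)

Mochizuki, *Semi-graphs of anabelioids*, Publ. RIMS **42** (2006), §3 Prop. 3.6 p. 38 ("`π₁^temp(G) :=
lim Gal(G_{∞,i}/G)` … independent, up to inner automorphism, of the choice of the cofinal system"), Ex. 3.10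
p. 44 ("an exhaustive sequence of open characteristic subgroups of finite index"), §5 Prop. 5.2 (i)/(iv) p. 63–64
(the levels must be stable under the arithmetic action). [cite: MochizukiSemiAnbd2006, Prop 3.6 p.38]

abc-iut cell, layer L3, row **T54·E1-J2(b)** (`HOME/plan/GAP-LEDGER.md` G-w4d053-1, E1 junction; L3-lead
α60; seat abc-iut-w4-d048 gen 3): the producer side of the capstone binder `hLst`.  abc-iut-L3-t9's tower
`galoisLevelData h36` is a FIXED enumeration (not E-stable); its constructor `GaloisLevelData.ofGaloisSeq`
(`GaloisLevelDataOfSeq.lean`) accepts any prescribed tower of Galois OBJECTS.  Here: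

* `GaloisLevelData.ofSubgroupSeq hc v₀ N hNo hNi hNn hanti` — Galois level data from a PRESCRIBED antitone
  sequence `N : ℕ → Subgroup (Aut (𝒢.fiberAt v₀))` of OPEN NORMAL FINITE-INDEX subgroups (levels
  `𝒢_{N k} = objOfSubgroup`, `GaloisObjectsOfSubgroups.lean`), with `stabilizer_basePt_seqObj : Stab = N k`;
  `exists_hom_seqObj_of_isConnected` / `ofSubgroupSeq_dominates` (a COFINAL `N` dominates every connected
  object, in particular every level of `galoisLevelData h36`) and
  `ofSubgroupSeq_exists_level_splits_component` = t9's cofinality clause `hcof` for the new tower;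
* **`GaloisLevelData.ofCharCores h36 v₀ hVt hEt`** — the instance at abc-iut-w4-d053's characteristic open
  cores `N k := charOpenCore (Aut (𝒢.fiberAt v₀)) k` (`CharacteristicOpenCore.lean`), which are open, normal,
  of finite index, antitone and cofinal by T54·E1b (`charOpenCore_autFiberAt_family`,
  `BoundedDegreeCoveringsFinite.lean`: FINITE semi-graph, topologically finitely generated vertex and edge
  groups) — with `ofCharCores_S`, the B(𝒢)-side level dictionary
  **`stabilizer_basePt_charCoreObj : Stab(base point of level k) = charOpenCore (Aut (𝒢.fiberAt v₀)) k`**,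
  the cofinality clause `ofCharCores_exists_level_splits_component`, and the E-STABILITY of the level
  subgroups under every bi-continuous automorphism of `π̂₁(𝒢)` (`map_charOpenCore_autFiberAt_eq`, d053's
  `map_charOpenCore_eq`).

What is NOT here (abc-iut-L3-t9's (J2)(a)/(c)): the Prop. 3.6 chart of this tower and the identification of
the kernels `ker π'_k ≤ π₁^temp` of its finite-level actions with `charOpenCore (π₁^temp) k`, which turn the
dictionary above into the capstone's `hLst` via t9's `hLst_of_ker_piLevelAut_eq_charOpenCore` (p432096).
Plumbing definitions (`seqObj`, `seqHom`, `ofSubgroupSeq`, `ofCharCores`, `charCoreObj`); no `Prop` fact, no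
instance, no notation.  Nothing here takes a side on [IUTchIII] Cor. 3.12.
-/

noncomputable section

namespace Literature.AnabelianGeometry.SemiGraphs

open CategoryTheory CategoryTheory.PreGaloisCategory Literature.AnabelianGeometry.Anabelioids
open Literature.AnabelianGeometry.AbsoluteAnabelian (IsTopologicallyFinitelyGenerated)
open scoped FintypeCatDiscrete

universe u

namespace ProfiniteSemiGraph

variable {𝒢 : ProfiniteSemiGraph.{u}}

/-! ### Galois level data from a prescribed antitone sequence of open normal finite-index subgroups -/

section Seq

variable (hc : 𝒢.graph.IsConnected) (v₀ : 𝒢.graph.Vertex) (N : ℕ → Subgroup (Aut (𝒢.fiberAt v₀)))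
  (hNo : ∀ k, IsOpen (N k : Set (Aut (𝒢.fiberAt v₀)))) (hNi : ∀ k, (N k).FiniteIndex)
  (hNn : ∀ k, (N k).Normal) (hanti : Antitone N)

/-- The `k`-th level object `𝒢_{N k}`. [cite: MochizukiSemiAnbd2006, Prop 3.6 p.38] -/
def seqObj (k : ℕ) : 𝒢.toAnab.BObj :=
  haveI := hNi k
  objOfSubgroup hc (N k) (hNo k)

include hNn in
/-- The level objects are Galois. [cite: MochizukiSemiAnbd2006, Prop 3.6 p.38] -/
theorem isGalois_seqObj (k : ℕ) :
    letI := SemiGraphOfAnabelioids.galoisCategory_bObj 𝒢.toAnab ⟨hc⟩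
    IsGalois (seqObj hc v₀ N hNo hNi k) := by
  haveI := hNi k
  haveI := hNn k
  exact isGalois_objOfSubgroup hc (N k) (hNo k)

include hanti in
/-- Transition morphisms exist along an antitone sequence. [cite: MochizukiSemiAnbd2006, Prop 3.6 p.38] -/
theorem exists_seqHom (k : ℕ) :
    ∃ f : seqObj hc v₀ N hNo hNi (k + 1) ⟶ seqObj hc v₀ N hNo hNi k,
      (𝒢.fiberAt v₀).map f (by haveI := hNi (k + 1); exact basePt hc (N (k + 1)) (hNo (k + 1))) =
        (by haveI := hNi k; exact basePt hc (N k) (hNo k)) := by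
  haveI := hNi k
  haveI := hNi (k + 1)
  exact exists_hom_of_le hc (N (k + 1)) (N k) (hNo (k + 1)) (hNo k) (hanti (Nat.le_succ k))

/-- The transition morphisms `𝒢_{N (k+1)} → 𝒢_{N k}` (a choice, base point to base point).
[cite: MochizukiSemiAnbd2006, Prop 3.6 p.38] -/
def seqHom (k : ℕ) : seqObj hc v₀ N hNo hNi (k + 1) ⟶ seqObj hc v₀ N hNo hNi k :=
  (exists_seqHom hc v₀ N hNo hNi hanti k).choose

/-- **Galois level data from a PRESCRIBED antitone sequence `N` of open normal finite-index subgroups of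
`π̂₁(𝒢) = Aut(fiberAt v₀)`** ([SemiAnbd] Prop. 3.6 p. 38 "some cofinal collection of connected finite étale
Galois coverings"; Ex. 3.10 p. 44): abc-iut-L3-t9's `GaloisLevelData.ofGaloisSeq` at the Galois objects
`𝒢_{N k}`. [cite: MochizukiSemiAnbd2006, Prop 3.6 p.38] -/
def _root_.Literature.AnabelianGeometry.SemiGraphs.ProfiniteSemiGraph.GaloisLevelData.ofSubgroupSeq :
    GaloisLevelData 𝒢 :=
  GaloisLevelData.ofGaloisSeq 𝒢 hc v₀ (seqObj hc v₀ N hNo hNi) (isGalois_seqObj hc v₀ N hNo hNi hNn)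
    (seqHom hc v₀ N hNo hNi hanti)

/-- The levels of `ofSubgroupSeq` are the coverings `𝒢_{N k}` (definitional).
[cite: MochizukiSemiAnbd2006, Prop 3.6 p.38] -/
theorem ofSubgroupSeq_S (k : ℕ) :
    (GaloisLevelData.ofSubgroupSeq hc v₀ N hNo hNi hNn hanti).S k =
      𝒢.ofBObj.obj (seqObj hc v₀ N hNo hNi k) := rfl

/-- The stabiliser in `Aut(fiberAt v₀)` of the base point of the `k`-th level object is EXACTLY `N k`.
[cite: MochizukiSemiAnbd2006, Prop 3.6 p.38] -/
theorem stabilizer_basePt_seqObj (k : ℕ) :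
    MulAction.stabilizer (Aut (𝒢.fiberAt v₀))
      (by haveI := hNi k; exact basePt hc (N k) (hNo k) :
        (𝒢.fiberAt v₀).obj (seqObj hc v₀ N hNo hNi k)) = N k := by
  haveI := hNi k
  exact stabilizer_basePt hc (N k) (hNo k)

/-- **Domination of connected objects by the levels** when `N` is COFINAL among the open finite-index
subgroups: every connected object of `B(𝒢)` receives a morphism from some `𝒢_{N k}`.
[cite: MochizukiSemiAnbd2006, Prop 3.6 p.38] -/
theorem exists_hom_seqObj_of_isConnected
    (hcof : ∀ U : Subgroup (Aut (𝒢.fiberAt v₀)), IsOpen (U : Set (Aut (𝒢.fiberAt v₀))) →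
      U.FiniteIndex → ∃ k, N k ≤ U)
    (X : 𝒢.toAnab.BObj)
    (hX : letI := SemiGraphOfAnabelioids.galoisCategory_bObj 𝒢.toAnab ⟨hc⟩; PreGaloisCategory.IsConnected X) :
    ∃ k, Nonempty (seqObj hc v₀ N hNo hNi k ⟶ X) := by
  letI := SemiGraphOfAnabelioids.galoisCategory_bObj 𝒢.toAnab ⟨hc⟩
  haveI := 𝒢.fiberFunctor_fiberAt hc v₀
  haveI := hX
  obtain ⟨x⟩ := nonempty_fiber_of_isConnected (𝒢.fiberAt v₀) X
  have hUo := isOpen_stabilizer_fiber (𝒢.fiberAt v₀) X x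
  haveI : (MulAction.stabilizer (Aut (𝒢.fiberAt v₀)) x).FiniteIndex := by
    refine ⟨?_⟩
    rw [index_stabilizer_fiber (𝒢.fiberAt v₀) X x]
    exact Nat.card_pos.ne'
  obtain ⟨k, hk⟩ := hcof _ hUo inferInstance
  haveI := hNi k
  obtain ⟨f, -⟩ := exists_hom_of_le_stabilizer hc (N k) (hNo k) X x hk
  exact ⟨k, ⟨f⟩⟩

/-- **The prescribed tower dominates abc-iut-L3-t9's tower `galoisLevelData h36`** (cofinal `N`): every
level of the latter receives a morphism from some level of `ofSubgroupSeq`.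
[cite: MochizukiSemiAnbd2006, Prop 3.6 p.38] -/
theorem ofSubgroupSeq_dominates (h36 : 𝒢.Prop36Hypotheses) (N : ℕ → Subgroup (Aut (𝒢.fiberAt v₀)))
    (hNo : ∀ k, IsOpen (N k : Set (Aut (𝒢.fiberAt v₀)))) (hNi : ∀ k, (N k).FiniteIndex)
    (hNn : ∀ k, (N k).Normal) (hanti : Antitone N)
    (hcof : ∀ U : Subgroup (Aut (𝒢.fiberAt v₀)), IsOpen (U : Set (Aut (𝒢.fiberAt v₀))) →
      U.FiniteIndex → ∃ k, N k ≤ U) (i : ℕ) :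
    ∃ k, Nonempty ((GaloisLevelData.ofSubgroupSeq h36.isConnected v₀ N hNo hNi hNn hanti).S k ⟶
      (𝒢.galoisLevelData h36).S i) := by
  letI := SemiGraphOfAnabelioids.galoisCategory_bObj 𝒢.toAnab ⟨h36.isConnected⟩
  haveI := 𝒢.isGalois_tower h36 i
  obtain ⟨k, ⟨f⟩⟩ := exists_hom_seqObj_of_isConnected h36.isConnected v₀ N hNo hNi hcof (𝒢.tower h36 i)
    inferInstance
  exact ⟨k, ⟨𝒢.ofBObj.map f⟩⟩

/-- **Cofinality of the prescribed tower** (the clause the chart machinery runs on): every component of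
every tempered covering is split by the levels `𝒢_{N k}` from some level on (abc-iut-L3-t9's
`ofGaloisSeq_exists_level_splits_component_of_dominates` fed with `ofSubgroupSeq_dominates`).
[cite: MochizukiSemiAnbd2006, Prop 3.6 p.38] -/
theorem ofSubgroupSeq_exists_level_splits_component (h36 : 𝒢.Prop36Hypotheses)
    (N : ℕ → Subgroup (Aut (𝒢.fiberAt v₀)))
    (hNo : ∀ k, IsOpen (N k : Set (Aut (𝒢.fiberAt v₀)))) (hNi : ∀ k, (N k).FiniteIndex)
    (hNn : ∀ k, (N k).Normal) (hanti : Antitone N)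
    (hcof : ∀ U : Subgroup (Aut (𝒢.fiberAt v₀)), IsOpen (U : Set (Aut (𝒢.fiberAt v₀))) →
      U.FiniteIndex → ∃ k, N k ≤ U)
    (T : CovObj 𝒢) (hT : T.IsTempered) (p : T.Point) :
    ∃ n : ℕ, ∀ m, n ≤ m →
      ((GaloisLevelData.ofSubgroupSeq h36.isConnected v₀ N hNo hNi hNn hanti).S m).Splits (T.component p) :=
  GaloisLevelData.ofGaloisSeq_exists_level_splits_component_of_dominates (𝒢 := 𝒢) (v₀ := v₀)
    (A := seqObj h36.isConnected v₀ N hNo hNi) (f := seqHom h36.isConnected v₀ N hNo hNi hanti)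
    (h36 := h36) (hA' := isGalois_seqObj h36.isConnected v₀ N hNo hNi hNn)
    (hdom := ofSubgroupSeq_dominates v₀ h36 N hNo hNi hNn hanti hcof) T hT p

end Seq

/-! ### The CHARACTERISTIC tower: levels `charOpenCore (Aut(fiberAt v₀)) k` (finite coherent `𝒢`) -/

section CharCores

variable [Finite 𝒢.graph.Vertex] [Finite 𝒢.graph.Branch]

/-- **The characteristic Galois tower `ofCharCores`** of a FINITE semi-graph of anabelioids satisfying
`Prop36Hypotheses` with topologically finitely generated vertex and edge groups: the tower `ofSubgroupSeq`
at abc-iut-w4-d053's characteristic open cores `charOpenCore (Aut (𝒢.fiberAt v₀)) k` — OPEN, NORMAL, of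
FINITE INDEX, antitone and cofinal by `charOpenCore_autFiberAt_family` (T54·E1b), hence E-stable for
every bi-continuous automorphism of `π̂₁(𝒢)` (`map_charOpenCore_eq`). [cite: MochizukiSemiAnbd2006, Ex 3.10 p.44] -/
def _root_.Literature.AnabelianGeometry.SemiGraphs.ProfiniteSemiGraph.GaloisLevelData.ofCharCores
    (h36 : 𝒢.Prop36Hypotheses) (v₀ : 𝒢.graph.Vertex)
    (hVt : ∀ v : 𝒢.graph.Vertex, IsTopologicallyFinitelyGenerated (𝒢.Gv v))
    (hEt : ∀ e : 𝒢.graph.Edge, IsTopologicallyFinitelyGenerated (𝒢.Ge e)) : GaloisLevelData 𝒢 :=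
  GaloisLevelData.ofSubgroupSeq h36.isConnected v₀ (fun k => charOpenCore (Aut (𝒢.fiberAt v₀)) k)
    (fun k => ((charOpenCore_autFiberAt_family 𝒢 h36.isConnected v₀ hVt hEt).2.1 k).1)
    (fun k => ((charOpenCore_autFiberAt_family 𝒢 h36.isConnected v₀ hVt hEt).2.1 k).2.2.1)
    (fun k => charOpenCore_normal k) (fun _ _ h => charOpenCore_anti h)

/-- Openness of the characteristic open cores of `Aut(fiberAt v₀)` (T54·E1b). [cite: MochizukiSemiAnbd2006, Ex 3.10 p.44] -/
theorem isOpen_charOpenCore_autFiberAt (h36 : 𝒢.Prop36Hypotheses) (v₀ : 𝒢.graph.Vertex)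
    (hVt : ∀ v : 𝒢.graph.Vertex, IsTopologicallyFinitelyGenerated (𝒢.Gv v))
    (hEt : ∀ e : 𝒢.graph.Edge, IsTopologicallyFinitelyGenerated (𝒢.Ge e)) (k : ℕ) :
    IsOpen (charOpenCore (Aut (𝒢.fiberAt v₀)) k : Set (Aut (𝒢.fiberAt v₀))) :=
  ((charOpenCore_autFiberAt_family 𝒢 h36.isConnected v₀ hVt hEt).2.1 k).1

/-- Finite index of the characteristic open cores of `Aut(fiberAt v₀)` (T54·E1b).
[cite: MochizukiSemiAnbd2006, Ex 3.10 p.44] -/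
theorem finiteIndex_charOpenCore_autFiberAt (h36 : 𝒢.Prop36Hypotheses) (v₀ : 𝒢.graph.Vertex)
    (hVt : ∀ v : 𝒢.graph.Vertex, IsTopologicallyFinitelyGenerated (𝒢.Gv v))
    (hEt : ∀ e : 𝒢.graph.Edge, IsTopologicallyFinitelyGenerated (𝒢.Ge e)) (k : ℕ) :
    (charOpenCore (Aut (𝒢.fiberAt v₀)) k).FiniteIndex :=
  ((charOpenCore_autFiberAt_family 𝒢 h36.isConnected v₀ hVt hEt).2.1 k).2.2.1

/-- **The `k`-th characteristic covering** `𝒢_{charOpenCore k}` (the level object of `ofCharCores`).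
[cite: MochizukiSemiAnbd2006, Ex 3.10 p.44] -/
def charCoreObj (h36 : 𝒢.Prop36Hypotheses) (v₀ : 𝒢.graph.Vertex)
    (hVt : ∀ v : 𝒢.graph.Vertex, IsTopologicallyFinitelyGenerated (𝒢.Gv v))
    (hEt : ∀ e : 𝒢.graph.Edge, IsTopologicallyFinitelyGenerated (𝒢.Ge e)) (k : ℕ) : 𝒢.toAnab.BObj :=
  seqObj h36.isConnected v₀ (fun k => charOpenCore (Aut (𝒢.fiberAt v₀)) k)
    (isOpen_charOpenCore_autFiberAt h36 v₀ hVt hEt) (finiteIndex_charOpenCore_autFiberAt h36 v₀ hVt hEt) k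

/-- The levels of `ofCharCores` are the characteristic coverings (definitional).
[cite: MochizukiSemiAnbd2006, Ex 3.10 p.44] -/
theorem ofCharCores_S (h36 : 𝒢.Prop36Hypotheses) (v₀ : 𝒢.graph.Vertex)
    (hVt : ∀ v : 𝒢.graph.Vertex, IsTopologicallyFinitelyGenerated (𝒢.Gv v))
    (hEt : ∀ e : 𝒢.graph.Edge, IsTopologicallyFinitelyGenerated (𝒢.Ge e)) (k : ℕ) :
    (GaloisLevelData.ofCharCores h36 v₀ hVt hEt).S k = 𝒢.ofBObj.obj (charCoreObj h36 v₀ hVt hEt k) := rfl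

/-- **Level dictionary, B(𝒢) side**: the stabiliser in `Aut(fiberAt v₀)` of the base point of the `k`-th
characteristic covering is EXACTLY `charOpenCore (Aut (𝒢.fiberAt v₀)) k`.
[cite: MochizukiSemiAnbd2006, Ex 3.10 p.44] -/
theorem stabilizer_basePt_charCoreObj (h36 : 𝒢.Prop36Hypotheses) (v₀ : 𝒢.graph.Vertex)
    (hVt : ∀ v : 𝒢.graph.Vertex, IsTopologicallyFinitelyGenerated (𝒢.Gv v))
    (hEt : ∀ e : 𝒢.graph.Edge, IsTopologicallyFinitelyGenerated (𝒢.Ge e)) (k : ℕ) :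
    MulAction.stabilizer (Aut (𝒢.fiberAt v₀))
      (@basePt 𝒢 h36.isConnected v₀ (charOpenCore (Aut (𝒢.fiberAt v₀)) k)
        (isOpen_charOpenCore_autFiberAt h36 v₀ hVt hEt k) (finiteIndex_charOpenCore_autFiberAt h36 v₀ hVt hEt k) :
          (𝒢.fiberAt v₀).obj (charCoreObj h36 v₀ hVt hEt k)) =
      charOpenCore (Aut (𝒢.fiberAt v₀)) k :=
  stabilizer_basePt_seqObj h36.isConnected v₀ _ _ _ k

/-- **Cofinality of the characteristic tower**: every component of every tempered covering of `𝒢` is split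
by the characteristic coverings from some level on. [cite: MochizukiSemiAnbd2006, Prop 3.6 p.38] -/
theorem ofCharCores_exists_level_splits_component (h36 : 𝒢.Prop36Hypotheses) (v₀ : 𝒢.graph.Vertex)
    (hVt : ∀ v : 𝒢.graph.Vertex, IsTopologicallyFinitelyGenerated (𝒢.Gv v))
    (hEt : ∀ e : 𝒢.graph.Edge, IsTopologicallyFinitelyGenerated (𝒢.Ge e))
    (T : CovObj 𝒢) (hT : T.IsTempered) (p : T.Point) :
    ∃ n : ℕ, ∀ m, n ≤ m → ((GaloisLevelData.ofCharCores h36 v₀ hVt hEt).S m).Splits (T.component p) :=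
  ofSubgroupSeq_exists_level_splits_component v₀ h36 _ _ _ _ _
    (fun U hU _ => ((charOpenCore_autFiberAt_family 𝒢 h36.isConnected v₀ hVt hEt).2.2 U hU inferInstance))
    T hT p

omit [Finite 𝒢.graph.Vertex] [Finite 𝒢.graph.Branch] in
/-- **E-stability of the characteristic levels**: every bi-continuous automorphism of `π̂₁(𝒢) =
Aut(fiberAt v₀)` fixes each level subgroup `charOpenCore _ k` (abc-iut-w4-d053's `map_charOpenCore_eq`).
[cite: MochizukiSemiAnbd2006, Ex 3.10 p.44] -/
theorem map_charOpenCore_autFiberAt_eq {v₀ : 𝒢.graph.Vertex} (φ : MulAut (Aut (𝒢.fiberAt v₀)))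
    (hφ : Continuous φ) (hφ' : Continuous φ.symm) (k : ℕ) :
    (charOpenCore (Aut (𝒢.fiberAt v₀)) k).map φ.toMonoidHom = charOpenCore (Aut (𝒢.fiberAt v₀)) k :=
  map_charOpenCore_eq φ hφ hφ'

end CharCores

end ProfiniteSemiGraph

end Literature.AnabelianGeometry.SemiGraphs

end
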